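import Mathlib
import Summits.Ventures.HodgeRepro2.Tier7.Line3.HeckeWindowIdeal

/-!
# Tier7/Line3/HeckeWindowSatake — Macdonald's display from the PRINTED Hecke relations (part VIII of the Hecke-window lane)
(parts I–III = HeckeWindowCounts / HeckeWindowSums / HeckeWindowLocus; IV–V = HeckeWindowIdeal / HeckeWindowIdealOrb;
VI–VII = HeckeWindowSix / HeckeWindowSixOrb)

Filer: t7-L1-p3 (gen 8, prover-pub-hodge-repro2-t7-L1-p3-g8-0), self-selected on the seat's own TARGET line (STATUS
l. 15844; twin window held). Lane: Line 3 SUPPORT, [M]-level; NOT a line, NOT a device; touches neither residual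
clause (a′) nor (b′) of the line.

WHAT IT SUPPLIES. Parts IV–VII define the Macdonald polynomials `mac κ x y n` (= `κ⁻ⁿ (h_n − κ² x y h_{n−2})`,
`κ = q^{−1/2}`) and prove the three-term relation and `Ŝ(F_n) = (x − c)(y − c) P_n` RELATIVE TO THAT DEFINITION; that
`mac` IS the Satake transform of `1_{K diag(ϖⁿ,1) K}` was left in words as «Macdonald's formula (print)» (HECKE-WINDOW-p3.md
§9.6 (iii); crit-2 records (b) of STATUS ll. 15763 / 15817). THIS FILE derives that display from the two PRINTED
propositions located for W-L1p3-1 (lit-4 l. 15821, lit-3 l. 15824; Bump 1997, *Automorphic Forms and Representations*,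
§4.6, held chunk layer — print pages unverified, cited by statement / equation number):
* (6.3) Prop. 4.6.4 [chunk p0494 ll. 7–9]: «If k ⩾ 1, we have T(𝔭) T(𝔭^k) = T(𝔭^{k+1}) + q R(𝔭) T(𝔭^{k−1}).» Here
  `T(𝔭^k)` = the characteristic function of `{g ∈ Mat₂(𝔬) : (det g) = 𝔭^k}` (`T(𝔭^0) = 1_K = 1`), `R(𝔭) = 1_{ϖK}`
  [p0494 ll. 3–5], `q` the residue cardinality;
* (6.6) Prop. 4.6.6 [chunk p0496 ll. 5–8]: «T(𝔭) φ_K = λ φ_K and R(𝔭) φ_K = μ φ_K, where λ = q^{1/2}(α₁ + α₂),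
  μ = α₁ α₂» — the spherical character `Ŝ` (= the Satake transform at the parameter `{α₁, α₂}`, Bump chunk p0374 l. 21);
* the basis change of Prop. 4.6.5's proof [chunk p0495 ll. 15–17]: `1_{K diag(ϖⁿ,1) K} = T(𝔭ⁿ) − R(𝔭) T(𝔭^{n−2})`
  (`n ≥ 2`; the layer's exponent «n−m−1» read as «n−m−2» by the determinant support, lit-4 / lit-3 l. 15825).
ABSTRACTLY: `A` any commutative `ℂ`-algebra, `T : ℕ → A` with `T 0 = 1`, `R : A`, `q : ℕ`, `S : A →ₐ[ℂ] ℂ`, and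
`κ α β : ℂ` with `κ² q = 1` — this fixes `κ = ±q^{−1/2}` only up to SIGN, and both signs satisfy the hypotheses with the
matching `S (T 1) = κ⁻¹(α + β)`; `mac` and the window are stated in `κ`, so nothing is lost and no square root is chosen
(plan-3's precision, STATUS l. 15847); hypotheses = (6.3) and (6.6) binder for binder. THEOREMS: (M1) `S (T k) = κ⁻ᵏ h_k(α, β)`
(`satake_T`); (M2) `S (charFn n) = mac κ α β n` for ALL `n` (`satake_charFn`) — Macdonald's display
`q^{n/2}(h_n − q⁻¹ αβ h_{n−2})`; (M3) the lane's Hecke relations hold IN `A` (`T1_mul_charFn_add_two`,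
`T1_mul_charFn_one`); (M4) the window ELEMENT `winFn n ∈ A` has `S (winFn n) = (α − c)(β − c) · mac κ α β n`
(`satake_winFn`), vanishing at every parameter containing `c` (`satake_winFn_root`).

WHAT STAYS IN WORDS after this file (the dictionary, (a′)): that the real spherical Hecke algebra `ℋ(GL₂(F_{v₂}) // K)`
with its spherical character at `π_{v₂}` is such a quadruple `(A, T, R, S)` — exactly the printed content of Bump
Prop. 4.6.4 / 4.6.6 and the definition of `T(𝔭^k)` — and the identification of the real objects (unchanged). Nothing
about `X`, (N) or (P) is claimed.

§8(d) (uses an L-value-free non-vanishing device): NO — a two-line induction and polynomial identities.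
-/

namespace Summit.Ventures.HodgeRepro2.Tier7.Line3.HeckeWindow

/-! ## K15. (M1) The Satake values of `T(𝔭^k)` from (6.3) + (6.6) -/

section Satake

variable {A : Type*} [CommRing A] [Algebra ℂ A]

/-- (K15) From `κ² q = 1`: `κ ≠ 0`. -/
theorem kappa_ne_zero_of_sq_mul (κ : ℂ) (q : ℕ) (hκq : κ ^ 2 * (q : ℂ) = 1) : κ ≠ 0 := by
  intro h
  rw [h] at hκq
  simp at hκq

/-- (K15) From `κ² q = 1`: `q = κ⁻²`. -/
theorem natCast_eq_inv_sq (κ : ℂ) (q : ℕ) (hκq : κ ^ 2 * (q : ℂ) = 1) : (q : ℂ) = κ⁻¹ ^ 2 := by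
  have hκ : κ ≠ 0 := kappa_ne_zero_of_sq_mul κ q hκq
  have hκu : κ * κ⁻¹ = 1 := mul_inv_cancel₀ hκ
  linear_combination (κ⁻¹ ^ 2) * hκq - ((q : ℂ) * (κ * κ⁻¹ + 1)) * hκu

/-- (K15) (M1) THE SATAKE VALUES OF `T(𝔭^k)`: under the printed relation (6.3) (`hrec`) with `T(𝔭^0) = 1` and the
printed eigenvalues (6.6) (`hS1`, `hSR`), `Ŝ(T(𝔭^k)) = q^{k/2} h_k(α, β) = κ⁻ᵏ h_k(α, β)` for every `k`
(the `h_k` recursion `(α + β) h_{k+1} = h_{k+2} + αβ h_k`, `add_mul_hpoly`). Two-step induction. `κ² q = 1` fixes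
`κ` only up to sign; either sign works with the matching `hS1`. -/
theorem satake_T (T : ℕ → A) (R : A) (q : ℕ) (S : A →ₐ[ℂ] ℂ) (κ α β : ℂ)
    (hκq : κ ^ 2 * (q : ℂ) = 1) (hT0 : T 0 = 1)
    (hrec : ∀ k : ℕ, 1 ≤ k → T 1 * T k = T (k + 1) + (q : A) * R * T (k - 1))
    (hS1 : S (T 1) = κ⁻¹ * (α + β)) (hSR : S R = α * β) (k : ℕ) :
    S (T k) = κ⁻¹ ^ k * hpoly α β k := by
  have hq : (q : ℂ) = κ⁻¹ ^ 2 := natCast_eq_inv_sq κ q hκq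
  -- the two-step induction hypothesis
  have key : ∀ k : ℕ, S (T k) = κ⁻¹ ^ k * hpoly α β k ∧
      S (T (k + 1)) = κ⁻¹ ^ (k + 1) * hpoly α β (k + 1) := by
    intro k
    induction k with
    | zero =>
      refine ⟨?_, ?_⟩
      · rw [hT0, map_one, hpoly_zero]; ring
      · show S (T 1) = κ⁻¹ ^ 1 * hpoly α β 1
        rw [hS1, hpoly_one]; ring
    | succ k ih =>
      obtain ⟨ih1, ih2⟩ := ih
      refine ⟨ih2, ?_⟩
      have h := hrec (k + 1) (by omega)
      rw [Nat.add_sub_cancel, show k + 1 + 1 = k + 2 by omega] at h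
      have e := congrArg S h
      rw [map_mul, map_add, map_mul, map_mul, map_natCast, hS1, hSR, ih1, ih2] at e
      have hA : (α + β) * hpoly α β (k + 1) = hpoly α β (k + 2) + α * β * hpoly α β k :=
        add_mul_hpoly α β k
      show S (T (k + 2)) = κ⁻¹ ^ (k + 2) * hpoly α β (k + 2)
      linear_combination -e + (κ⁻¹ ^ (k + 2)) * hA - (α * β * κ⁻¹ ^ k * hpoly α β k) * hq
  exact (key k).1

end Satake

/-! ## K16. (M2) The printed basis change and Macdonald's display -/

section CharFn

variable {A : Type*} [CommRing A]

/-- (K16) The printed basis change [Bump Prop. 4.6.5's proof]: the characteristic function of `K diag(ϖⁿ, 1) K` as an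
element of the algebra generated by the `T(𝔭^k)` and `R(𝔭)`: `charFn n = T(𝔭ⁿ) − R(𝔭) T(𝔭^{n−2})` for `n ≥ 2`,
`= T(𝔭ⁿ)` for `n ≤ 1` (`T(𝔭^k) = Σ_{r ≤ k/2} R(𝔭)^r 1_{K diag(ϖ^{k−2r},1) K}`, p0494 ll. 3–5). -/
def charFn (T : ℕ → A) (R : A) : ℕ → A
  | 0 => T 0
  | 1 => T 1
  | n + 2 => T (n + 2) - R * T n

/-- `charFn 0 = T(𝔭^0)`. -/
theorem charFn_zero (T : ℕ → A) (R : A) : charFn T R 0 = T 0 := rfl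

/-- `charFn 1 = T(𝔭)`. -/
theorem charFn_one (T : ℕ → A) (R : A) : charFn T R 1 = T 1 := rfl

/-- `charFn (n+2) = T(𝔭^{n+2}) − R(𝔭) T(𝔭ⁿ)`. -/
theorem charFn_add_two (T : ℕ → A) (R : A) (n : ℕ) : charFn T R (n + 2) = T (n + 2) - R * T n := rfl

/-- (K16) (M3) THE LANE'S HECKE RELATION, `n ≥ 2`, IN `A`: `T_ϖ T_{(n,0)} = T_{(n+1,0)} + q · 1_{ϖK} T_{(n−1,0)}`
(HeckeWindowIdeal's docstring), from the printed (6.3) and `T(𝔭^0) = 1` alone. -/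
theorem T1_mul_charFn_add_two (T : ℕ → A) (R : A) (q : ℕ) (hT0 : T 0 = 1)
    (hrec : ∀ k : ℕ, 1 ≤ k → T 1 * T k = T (k + 1) + (q : A) * R * T (k - 1)) (n : ℕ) :
    T 1 * charFn T R (n + 2) = charFn T R (n + 3) + (q : A) * R * charFn T R (n + 1) := by
  match n with
  | 0 =>
    have h2 : T 1 * T 2 = T 3 + (q : A) * R * T 1 := hrec 2 (by omega)
    show T 1 * (T 2 - R * T 0) = (T 3 - R * T 1) + (q : A) * R * T 1
    rw [hT0, mul_one]
    linear_combination h2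
  | m + 1 =>
    have h3 : T 1 * T (m + 3) = T (m + 4) + (q : A) * R * T (m + 2) := by
      have := hrec (m + 3) (by omega)
      rwa [show m + 3 + 1 = m + 4 by omega, show m + 3 - 1 = m + 2 by omega] at this
    have h1 : T 1 * T (m + 1) = T (m + 2) + (q : A) * R * T m := by
      have := hrec (m + 1) (by omega)
      rwa [show m + 1 + 1 = m + 2 by omega, Nat.add_sub_cancel] at this
    show T 1 * (T (m + 3) - R * T (m + 1)) =
      (T (m + 4) - R * T (m + 2)) + (q : A) * R * (T (m + 2) - R * T m)
    linear_combination h3 - R * h1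

/-- (K16) (M3) THE LANE'S SECOND HECKE RELATION IN `A`: `T_ϖ² = T_{(2,0)} + (q + 1) · 1_{ϖK}`, from (6.3) at `k = 1`
and `T(𝔭^0) = 1`. -/
theorem T1_mul_charFn_one (T : ℕ → A) (R : A) (q : ℕ) (hT0 : T 0 = 1)
    (hrec : ∀ k : ℕ, 1 ≤ k → T 1 * T k = T (k + 1) + (q : A) * R * T (k - 1)) :
    T 1 * charFn T R 1 = charFn T R 2 + ((q : A) + 1) * R := by
  have h1 : T 1 * T 1 = T 2 + (q : A) * R * T 0 := hrec 1 le_rfl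
  rw [hT0, mul_one] at h1
  show T 1 * T 1 = (T 2 - R * T 0) + ((q : A) + 1) * R
  rw [hT0, mul_one]
  linear_combination h1

end CharFn

section Macdonald

variable {A : Type*} [CommRing A] [Algebra ℂ A]

/-- (K16) (M2) MACDONALD'S DISPLAY FROM PRINT: under (6.3) + (6.6), `Ŝ(1_{K diag(ϖⁿ,1) K}) = mac κ α β n`
`= q^{n/2}(h_n − q⁻¹ αβ h_{n−2})` for EVERY `n` — parts IV–VII's `mac` is the Satake value of the printed basis element. -/
theorem satake_charFn (T : ℕ → A) (R : A) (q : ℕ) (S : A →ₐ[ℂ] ℂ) (κ α β : ℂ)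
    (hκq : κ ^ 2 * (q : ℂ) = 1) (hT0 : T 0 = 1)
    (hrec : ∀ k : ℕ, 1 ≤ k → T 1 * T k = T (k + 1) + (q : A) * R * T (k - 1))
    (hS1 : S (T 1) = κ⁻¹ * (α + β)) (hSR : S R = α * β) (n : ℕ) :
    S (charFn T R n) = mac κ α β n := by
  have hκ : κ ≠ 0 := kappa_ne_zero_of_sq_mul κ q hκq
  have hκu : κ * κ⁻¹ = 1 := mul_inv_cancel₀ hκ
  have hT := satake_T T R q S κ α β hκq hT0 hrec hS1 hSR
  match n with
  | 0 => rw [charFn_zero, hT 0, mac_zero, hpoly_zero]; ring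
  | 1 => rw [charFn_one, hT 1, mac_one, hpoly_one]; ring
  | n + 2 =>
    rw [charFn_add_two, map_sub, map_mul, hSR, hT (n + 2), hT n]
    show κ⁻¹ ^ (n + 2) * hpoly α β (n + 2) - α * β * (κ⁻¹ ^ n * hpoly α β n) =
      κ⁻¹ ^ (n + 2) * (hpoly α β (n + 2) - κ ^ 2 * α * β * hpoly α β n)
    linear_combination (α * β * κ⁻¹ ^ n * hpoly α β n * (κ * κ⁻¹ + 1)) * hκu

end Macdonald

/-! ## K17. (M4) The window ELEMENT of the algebra and its Satake value -/

section Window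

variable {A : Type*} [CommRing A] [Algebra ℂ A]

/-- (K17) The `n`-th window ELEMENT `F_n = 1_{ϖK} T_{(n,0)} − cκ T_{(n+1,0)} − c l_n 1_{ϖK} T_{(n−1,0)} + c² T_{(n,0)}`
of HeckeWindowIdeal's docstring, as an element of `A` (`T_{(m,0)} = charFn m`, `1_{ϖK} = R`, `l_n = lowCoeff κ n`). -/
noncomputable def winFn (T : ℕ → A) (R : A) (c κ : ℂ) (n : ℕ) : A :=
  R * charFn T R n - (c * κ) • charFn T R (n + 1) - (c * lowCoeff κ n) • (R * charFn T R (n - 1)) +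
    (c ^ 2) • charFn T R n

/-- (K17) (M4) THE SATAKE VALUE OF THE WINDOW ELEMENT: under (6.3) + (6.6), `Ŝ(F_n) = (α − c)(β − c) · mac κ α β n`
(`satake_window_n` of part IV, now about an element of the algebra rather than about `mac` alone). -/
theorem satake_winFn (T : ℕ → A) (R : A) (q : ℕ) (S : A →ₐ[ℂ] ℂ) (κ α β c : ℂ)
    (hκq : κ ^ 2 * (q : ℂ) = 1) (hT0 : T 0 = 1)
    (hrec : ∀ k : ℕ, 1 ≤ k → T 1 * T k = T (k + 1) + (q : A) * R * T (k - 1))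
    (hS1 : S (T 1) = κ⁻¹ * (α + β)) (hSR : S R = α * β) (n : ℕ) :
    S (winFn T R c κ n) = (α - c) * (β - c) * mac κ α β n := by
  have hκ : κ ≠ 0 := kappa_ne_zero_of_sq_mul κ q hκq
  have hc := satake_charFn T R q S κ α β hκq hT0 hrec hS1 hSR
  unfold winFn
  rw [map_add, map_sub, map_sub, map_mul, map_smul, map_smul, map_smul, map_mul, hSR, hc n,
    hc (n + 1), hc (n - 1)]
  simp only [smul_eq_mul]
  have hw := satake_window_n κ α β c hκ n
  linear_combination hw

/-- (K17) THE WINDOW ELEMENT KILLS THE POLE CLASS: at a parameter `{α, β}` containing `c`, `Ŝ(F_n) = 0`. -/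
theorem satake_winFn_root (T : ℕ → A) (R : A) (q : ℕ) (S : A →ₐ[ℂ] ℂ) (κ α β c : ℂ)
    (hκq : κ ^ 2 * (q : ℂ) = 1) (hT0 : T 0 = 1)
    (hrec : ∀ k : ℕ, 1 ≤ k → T 1 * T k = T (k + 1) + (q : A) * R * T (k - 1))
    (hS1 : S (T 1) = κ⁻¹ * (α + β)) (hSR : S R = α * β) (hc : c = α ∨ c = β) (n : ℕ) :
    S (winFn T R c κ n) = 0 := by
  rw [satake_winFn T R q S κ α β c hκq hT0 hrec hS1 hSR n]
  rcases hc with h | h <;> rw [h] <;> ring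

end Window

end Summit.Ventures.HodgeRepro2.Tier7.Line3.HeckeWindow
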